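import Summits.Ventures.Crystal3D.Theorems.StickyWulffConstantGenericWallFloorRunCountUpper
import Summits.Ventures.Crystal3D.Theorems.StickyWulffConstantGenericWallFloorSlotCharts
import Summits.Ventures.Crystal3D.Theorems.StickyWulffConstantGenericWallFloorGrainCredits
import HarnessLib

/-!
# Run ends of one bond class in a window of a MOVED lattice, counted from above

HONEST FRAMING. Part of the venture `Summits/Ventures/Crystal3D` (cell `crystal3d-full`), helper for the
crux `CoaxialWallLaw` (stmt-Ventures-19481) of `route-Ventures-StickyWulffConstant`, REGISTERED line
`WallLedgerF` (planner cf-p1 gen 16), open stub `stub_coaxialTwoSlabAdhesion` (general fillings).  Brick 7 of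
the FLUX-GAP architecture (memo F-FLUXGAP-ARCH §2): the SHALLOW BAND of transmitted ends
(`…CoaxialWallLawAutomatonTrans`) is counted by bond lines.  Pure lattice counting; rung credit only; F-C1
not moved.

* `card_filter_add_notMem_le_lineCount_moved` — for the window sample
  `P = (A·Λ₀ + t) ∩ {a ≤ p₂ ≤ a + R, p₀² + p₁² ≤ ρ²}` of a moved fcc lattice and a slot `w` with
  `α = ⟪A w, e₃⟫ ≠ 0`, the `w`-run ends `#{p ∈ P : p + A w ∉ P}` number at most
  `√2 |α| π (ρ + (R/2 + 4)/|α|)²` — lane G's model-coordinate count `card_filter_add_notMem_le_lineCount`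
  (`…GenericWallFloorRunCountUpper`) transported through the rigid motion (pull-back as in
  `tops_ge_lineCount`, charts `exists_chart_of_mem_fccSlots`).
* `card_band_le_lineCount` — the band of a complete top sample: the balls `s ∈ P₂` with
  `zcut ≤ s₂ < zcut + ⟪sh, e₃⟫` (`sh = A u` a rising slot, `[zcut, h + 2R₀]` inside the window) are run ends
  of the class `−u` in the window `[zcut, h + 2R₀]`, hence number at most
  `√2 ⟪sh, e₃⟫ π (ρ + ((h + 2R₀ − zcut)/2 + 4)/⟪sh, e₃⟫)²` — the FLUX CAPACITY of the shallow beam.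

WHAT THIS IS NOT: not the stub; F-C1 not moved.
-/

noncomputable section

namespace Summit.Ventures.Crystal3D.Theorems

open Summit.Ventures.Crystal3D Finset Matrix
open Literature.MathematicalPhysics.StatisticalMechanics (barlowPos fccStacking constHagg barlowPos_mem)
open scoped InnerProductSpace

/-- **Run ends of a transversal class in a window of a moved lattice, from above.**  See the module
docstring. -/
theorem card_filter_add_notMem_le_lineCount_moved
    (A : EuclideanSpace ℝ (Fin 3) ≃ₗᵢ[ℝ] EuclideanSpace ℝ (Fin 3)) (t : EuclideanSpace ℝ (Fin 3))
    (a R ρ : ℝ) (hR : 0 ≤ R) (hρ : 0 ≤ ρ) (P : Finset (EuclideanSpace ℝ (Fin 3)))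
    (hP : ∀ p, p ∈ P ↔ (p ∈ (fun q => A q + t) '' fccStacking 1 (Real.sqrt (2 / 3)) ∧
      a ≤ p 2 ∧ p 2 ≤ a + R ∧ p 0 ^ 2 + p 1 ^ 2 ≤ ρ ^ 2))
    {w : EuclideanSpace ℝ (Fin 3)} (hw : w ∈ fccSlots)
    (hα : ⟪A w, EuclideanSpace.single (2 : Fin 3) (1 : ℝ)⟫_ℝ ≠ 0) :
    ((P.filter fun p => p + A w ∉ P).card : ℝ) ≤
      Real.sqrt 2 * |⟪A w, EuclideanSpace.single (2 : Fin 3) (1 : ℝ)⟫_ℝ| * Real.pi *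
        (ρ + (R / 2 + 4) / |⟪A w, EuclideanSpace.single (2 : Fin 3) (1 : ℝ)⟫_ℝ|) ^ 2 := by
  classical
  set e₃ : EuclideanSpace ℝ (Fin 3) := EuclideanSpace.single (2 : Fin 3) (1 : ℝ) with he₃
  set ν : EuclideanSpace ℝ (Fin 3) := A.symm e₃ with hν
  set s : EuclideanSpace ℝ (Fin 3) := A.symm t with hs
  have he₃n : ‖e₃‖ = 1 := by rw [he₃, PiLp.norm_single, norm_one]
  have hνn : ‖ν‖ = 1 := by rw [hν, LinearIsometryEquiv.norm_map, he₃n]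
  have hAν : A ν = e₃ := by rw [hν, LinearIsometryEquiv.apply_symm_apply]
  have hAs : A s = t := by rw [hs, LinearIsometryEquiv.apply_symm_apply]
  have hαw : ⟪A w, e₃⟫_ℝ = ⟪w, ν⟫_ℝ := by rw [← hAν, LinearIsometryEquiv.inner_map_map]
  rw [hαw] at hα ⊢
  -- the motion and its inverse
  let g : EuclideanSpace ℝ (Fin 3) → EuclideanSpace ℝ (Fin 3) := fun q => A q + t
  let ginv : EuclideanSpace ℝ (Fin 3) → EuclideanSpace ℝ (Fin 3) := fun p => A.symm (p - t)
  have hg_ginv : ∀ p, g (ginv p) = p := by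
    intro p; simp only [g, ginv, LinearIsometryEquiv.apply_symm_apply, sub_add_cancel]
  have hginv_g : ∀ q, ginv (g q) = q := by
    intro q; simp only [g, ginv, add_sub_cancel_right, LinearIsometryEquiv.symm_apply_apply]
  have hginv_inj : Function.Injective ginv := by
    intro p p' h
    have := congrArg g h
    rwa [hg_ginv, hg_ginv] at this
  have hgq : ∀ q, g q = A (q + s) := by intro q; simp only [g, map_add, hAs]
  have h2 : ∀ q, g q 2 = ⟪q + s, ν⟫_ℝ := by
    intro q
    have : g q 2 = ⟪g q, e₃⟫_ℝ := by rw [he₃, EuclideanSpace.inner_single_right]; simp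
    rw [this, hgq, ← hAν, LinearIsometryEquiv.inner_map_map]
  have hlat : ∀ q, g q 0 ^ 2 + g q 1 ^ 2 = ‖q + s‖ ^ 2 - ⟪q + s, ν⟫_ℝ ^ 2 := by
    intro q
    rw [sq_add_sq_eq_norm_sq_sub, ← he₃, hgq, LinearIsometryEquiv.norm_map, ← hAν,
      LinearIsometryEquiv.inner_map_map]
  -- the pulled-back sample
  set P' : Finset (EuclideanSpace ℝ (Fin 3)) := P.image ginv with hP'
  have hmemP' : ∀ q, q ∈ P' ↔ g q ∈ P := by
    intro q
    rw [hP', mem_image]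
    constructor
    · rintro ⟨p, hp, rfl⟩; rwa [hg_ginv]
    · intro hq; exact ⟨g q, hq, hginv_g q⟩
  have hP'iff : ∀ q, q ∈ P' ↔ (q ∈ fccStacking 1 (Real.sqrt (2 / 3)) ∧ a ≤ ⟪q + s, ν⟫_ℝ ∧
      ⟪q + s, ν⟫_ℝ ≤ a + R ∧ ‖q + s‖ ^ 2 - ⟪q + s, ν⟫_ℝ ^ 2 ≤ ρ ^ 2) := by
    intro q
    rw [hmemP', hP]
    have e2 := h2 q
    have el := hlat q
    constructor
    · rintro ⟨⟨q', hq', hqq'⟩, h1, h2', h3⟩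
      have hq'q : q' = q := by
        have h0 : ginv (g q') = ginv (g q) := congrArg ginv hqq'
        rwa [hginv_g, hginv_g] at h0
      rw [e2] at h1 h2'
      rw [el] at h3
      exact ⟨hq'q ▸ hq', h1, h2', h3⟩
    · rintro ⟨hq, h1, h2', h3⟩
      refine ⟨⟨q, hq, rfl⟩, ?_, ?_, ?_⟩
      · rw [e2]; exact h1
      · rw [e2]; exact h2'
      · rw [el]; exact h3
  -- the run ends correspond
  have hcorr : (P.filter fun p => p + A w ∉ P).card = (P'.filter fun q => q + w ∉ P').card := by
    have himage : P'.filter (fun q => q + w ∉ P') = (P.filter fun p => p + A w ∉ P).image ginv := by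
      rw [hP', filter_image]
      congr 1
      ext p
      simp only [mem_filter]
      refine and_congr_right fun hp => ?_
      rw [hmemP']
      have : g (ginv p + w) = p + A w := by
        simp only [g, ginv, map_add, LinearIsometryEquiv.apply_symm_apply]; abel
      rw [this]
    rw [himage, card_image_of_injective _ hginv_inj]
  rw [hcorr]
  obtain ⟨Ea, Eb, hEa, hEb, hdet, fa, fb, ft, hchart⟩ := exists_chart_of_mem_fccSlots hw
  exact card_filter_add_notMem_le_lineCount ν s hνn a R ρ hR hρ P' hP'iff Ea Eb w hEa hEb
    (norm_eq_one_of_mem_fccSlots hw) hdet hα hw fa fb ft hchart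

/-- **The shallow band is a flux.**  See the module docstring. -/
theorem card_band_le_lineCount
    (A : EuclideanSpace ℝ (Fin 3) ≃ₗᵢ[ℝ] EuclideanSpace ℝ (Fin 3)) (t : EuclideanSpace ℝ (Fin 3))
    (P₂ : Finset (EuclideanSpace ℝ (Fin 3))) (h R₀ ρ zcut : ℝ) (hρ : 0 ≤ ρ)
    (hz1 : h + R₀ ≤ zcut) (hz2 : zcut ≤ h + 2 * R₀)
    (hP₂ : ∀ p, p ∈ P₂ ↔ (p ∈ (fun q => A q + t) '' fccStacking 1 (Real.sqrt (2 / 3)) ∧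
      h + R₀ ≤ p 2 ∧ p 2 ≤ h + 2 * R₀ ∧ p 0 ^ 2 + p 1 ^ 2 ≤ ρ ^ 2))
    {u : EuclideanSpace ℝ (Fin 3)} (hu : u ∈ fccSlots)
    (hpos : 0 < ⟪A u, EuclideanSpace.single (2 : Fin 3) (1 : ℝ)⟫_ℝ) :
    ((P₂.filter fun s => zcut ≤ s 2 ∧ s 2 < zcut + (A u) 2).card : ℝ) ≤
      Real.sqrt 2 * ⟪A u, EuclideanSpace.single (2 : Fin 3) (1 : ℝ)⟫_ℝ * Real.pi *
        (ρ + ((h + 2 * R₀ - zcut) / 2 + 4) / ⟪A u, EuclideanSpace.single (2 : Fin 3) (1 : ℝ)⟫_ℝ) ^ 2 := by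
  classical
  -- the window sample above the cut
  set Q : Finset (EuclideanSpace ℝ (Fin 3)) := P₂.filter fun p => zcut ≤ p 2 with hQ
  have hQ' : ∀ p, p ∈ Q ↔ (p ∈ (fun q => A q + t) '' fccStacking 1 (Real.sqrt (2 / 3)) ∧
      zcut ≤ p 2 ∧ p 2 ≤ zcut + (h + 2 * R₀ - zcut) ∧ p 0 ^ 2 + p 1 ^ 2 ≤ ρ ^ 2) := by
    intro p
    rw [hQ, mem_filter, hP₂, show zcut + (h + 2 * R₀ - zcut) = h + 2 * R₀ by ring]
    constructor
    · rintro ⟨⟨hΛ, -, h2, h3⟩, hz⟩; exact ⟨hΛ, hz, h2, h3⟩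
    · rintro ⟨hΛ, hz, h2, h3⟩; exact ⟨⟨hΛ, by linarith, h2, h3⟩, hz⟩
  have hu2 : (A u) 2 = ⟪A u, EuclideanSpace.single (2 : Fin 3) (1 : ℝ)⟫_ℝ := apply_two_eq_inner_e₃ (A u)
  -- the band consists of `(−u)`-run ends of `Q`
  have hsub : (P₂.filter fun s => zcut ≤ s 2 ∧ s 2 < zcut + (A u) 2) ⊆ Q.filter fun p => p + A (-u) ∉ Q := by
    intro p hp
    rw [mem_filter] at hp ⊢
    obtain ⟨hpP, hz, hlt⟩ := hp
    refine ⟨by rw [hQ, mem_filter]; exact ⟨hpP, hz⟩, fun hmem => ?_⟩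
    rw [hQ, mem_filter] at hmem
    have : (p + A (-u)) 2 = p 2 - (A u) 2 := by rw [map_neg, PiLp.add_apply, PiLp.neg_apply]; ring
    rw [this] at hmem
    linarith [hmem.2]
  have hαneg : ⟪A (-u), EuclideanSpace.single (2 : Fin 3) (1 : ℝ)⟫_ℝ =
      -⟪A u, EuclideanSpace.single (2 : Fin 3) (1 : ℝ)⟫_ℝ := by rw [map_neg, inner_neg_left]
  have hcount := card_filter_add_notMem_le_lineCount_moved A t zcut (h + 2 * R₀ - zcut) ρ (by linarith) hρ Q
    hQ' (neg_mem_fccSlots hu) (by rw [hαneg]; exact neg_ne_zero.2 hpos.ne')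
  rw [hαneg, abs_neg, abs_of_pos hpos] at hcount
  have hle : ((P₂.filter fun s => zcut ≤ s 2 ∧ s 2 < zcut + (A u) 2).card : ℝ) ≤
      ((Q.filter fun p => p + A (-u) ∉ Q).card : ℝ) := by exact_mod_cast card_le_card hsub
  exact hle.trans hcount

end Summit.Ventures.Crystal3D.Theorems

end
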